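import Literature.Order.Ordinal.NaturalSum
import Literature.Algebra.EuclideanDomain.TransfiniteSmallestAlgorithmSuperadditive
import HarnessLib

/-!
# Lenstra's superadditivity with the natural sum: `τ(xy) ≥ τ(x) ⊕ τ(y)` (Conidis–Nielsen–Tombs 2019, Lemma 5)

Topic `Literature/Algebra/EuclideanDomain`, namespace `Literature.Algebra.EuclideanDomain`.  THEOREMS ONLY (no `def`, no
instance, no named fact), all proved, in the vocabulary of `TransfiniteSmallestAlgorithm.lean` (`samuelSet R α = A_α`,
`samuelRank = θ`; the minimal Euclidean norm of Conidis–Nielsen–Tombs is `τ = θ − 1` on non-zero elements) and of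
`Literature/Order/Ordinal/NaturalSum.lean` (`nadd α β = α ⊕ β`, the Hessenberg–Brookfield natural sum).  This is the
`TODO(general form)` of `TransfiniteSmallestAlgorithmSuperadditive.lean` («Lemma 5 with the Hessenberg natural sum
`τ(x) ⊕ τ(y)` (≥ both ordinal sums)») and of `MinimalEuclideanFunctionSuperadditive.lean`, which prove the ordinal-sum and
the `ℕ`-valued forms.

## Source (read at the page)

C. Conidis, P. P. Nielsen, V. Tombs, *Transfinitely valued Euclidean domains have arbitrary indecomposable order type*,
Comm. Algebra **47** (2019) [ConidisNielsenTombs2019] (materialised `paper:arxiv-1703.02631`), §3, VERBATIM: «Lemma 5.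
Let `R` be a Euclidean domain with minimal Euclidean norm `τ`.  If `x, y ∈ R ∖ {0}`, then `τ(xy) ≥ τ(x) ⊕ τ(y)`.»
(attributed to «Proposition 3.4 in Lenstra's lecture notes [Lenstra] … by essentially the same proof, which we therefore
do not include»); proof of Corollary 6: «`τ(x^{n₁+1}) ≥ ⊕_{i=1}^{n₁+1} τ(x) = ω^{α₁}(n₁ + 1) > ρ(R)`».  §2: «The Hessenberg
sum of `γ` and `δ` … `γ ⊕ δ = Σ ω^{αᵢ}(mᵢ + nᵢ)`.  Unlike ordinary ordinal addition, Hessenberg summation is commutative and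
cancellative.»  Prop. 4: «`τ(x) = min {α ∈ Ord : x ∈ S_α(R)}` is a Euclidean norm on `R` … minimal».

## What is formalised

* **Lemma 5 as printed**: `nadd (θ x − 1) (θ y − 1) ≤ θ(xy) − 1` for `x, y ≠ 0` in a domain exhausted by its transfinite
  construction (**`samuelRank_sub_one_nadd_le`**).  The (unprinted) proof is the induction on `θ(xy)` of the tree's
  ordinal-sum version, run through the recursion `α ⊕ β = sup (α′ ⊕ β + 1, α ⊕ β′ + 1)`: for `a′ < τ(x)` a class
  `c + xR` avoids the stages `≤ a′`; the class of `cy` mod `xy` has a representative `w = zy`, `z ∈ c + xR`, of smaller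
  `θ`, and by induction `a′ ⊕ τ(y) ≤ τ(z) ⊕ τ(y) ≤ τ(zy) < τ(xy)` — no case distinction is needed for the natural sum.
* the proof of Corollary 6's display: `⊕_{i≤n} τ(x) ≤ τ(xⁿ)` with the `n`-fold natural sum
  (`samuelRank_sub_one_nadd_iterate_le`), and the tree's ordinal-sum forms recovered from `α + β ≤ α ⊕ β`
  (`samuelRank_sub_one_add_le_of_nadd`).

## Mathlib / tree search

Tree: `NaturalSum.lean` (`nadd_le_iff`, `nadd_le_nadd_right/left`, `nadd_comm`, `add_le_nadd`, `nadd_zero`),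
`TransfiniteSmallestAlgorithmSuperadditive.lean` (`exists_coset_forall_le_samuelRank`, `one_add_samuelRank_sub_one`,
`samuelRank_sub_one_add_le` — the ordinal-sum version, not re-proved but re-derived), `TransfiniteSmallestAlgorithm.lean`
(`forall_of_mem_samuelSet`, `mem_samuelSet_samuelRank`, `samuelRank_le_of_mem`).  Mathlib: `Function.iterate_succ_apply'`,
`Ordinal.le_sub_of_add_le`, `add_lt_add_iff_left`.
-/

namespace Literature.Algebra.EuclideanDomain

open Ordinal Literature.Order.Ordinal

universe u

variable {R : Type u} [CommRing R] [IsDomain R]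

/-- **Lemma 5 (Lenstra's Proposition 3.4) with the natural sum.** «Let `R` be a Euclidean domain with minimal Euclidean
norm `τ`.  If `x, y ∈ R ∖ {0}`, then `τ(xy) ≥ τ(x) ⊕ τ(y)`» — for a domain exhausted by its transfinite construction and
`τ = θ − 1`. [cite: ConidisNielsenTombs2019, Lemma 5 (§3)] -/
theorem samuelRank_sub_one_nadd_le (h : ∀ z : R, ∃ β : Ordinal.{u}, z ∈ samuelSet R β) {x y : R} (hx : x ≠ 0)
    (hy : y ≠ 0) : nadd (samuelRank x - 1) (samuelRank y - 1) ≤ samuelRank (x * y) - 1 := by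
  suffices H : ∀ o : Ordinal.{u}, ∀ x y : R, x ≠ 0 → y ≠ 0 → samuelRank (x * y) = o →
      nadd (samuelRank x - 1) (samuelRank y - 1) ≤ o - 1 from H _ x y hx hy rfl
  intro o
  induction o using WellFoundedLT.induction with
  | ind o ih =>
    intro x y hx hy hxy
    have hxy0 : x * y ≠ 0 := mul_ne_zero hx hy
    have ho1 : 1 + (o - 1) = o := hxy ▸ one_add_samuelRank_sub_one h hxy0
    -- the representative trick: for `γ < θ(u)` a class mod `u` avoids `A_β`, `β < γ`; multiplying it by `v` and reducing
    -- mod `uv = xy` gives `w = zv`, `θ(z) ≥ γ`, `θ(w) < θ(xy)`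
    have key : ∀ (u v : R), u ≠ 0 → v ≠ 0 → u * v = x * y → ∀ γ : Ordinal.{u}, 0 < γ → γ < samuelRank u →
        ∃ z w : R, z ≠ 0 ∧ γ ≤ samuelRank z ∧ w = z * v ∧ samuelRank w < o := by
      intro u v hu hv huv γ hγ0 hγ
      obtain ⟨c, hc⟩ := exists_coset_forall_le_samuelRank h hγ hγ0
      have hmem : x * y ∈ samuelSet R (samuelRank (x * y)) := mem_samuelSet_samuelRank (h _)
      obtain ⟨β, hβ, w, hw, t, ht⟩ := forall_of_mem_samuelSet hmem hxy0 (c * v)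
      refine ⟨c + u * (-t), w, (hc (-t)).1, (hc (-t)).2, ?_, ?_⟩
      · rw [← huv] at ht
        linear_combination -ht
      · exact hxy ▸ (samuelRank_le_of_mem hw).trans_lt hβ
    -- the step `a′ < τ(u) ⟹ a′ ⊕ τ(v) < o − 1` for `{u, v} = {x, y}`
    have step : ∀ (u v : R), u ≠ 0 → v ≠ 0 → u * v = x * y →
        (∀ z : R, z ≠ 0 → samuelRank (z * v) < o →
          nadd (samuelRank z - 1) (samuelRank v - 1) ≤ samuelRank (z * v) - 1) →
        ∀ a' < samuelRank u - 1, nadd a' (samuelRank v - 1) < o - 1 := by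
      intro u v hu hv huv IH a' ha'
      -- `γ = 1 + a′ < θ(u)`
      have hγ : 1 + a' < samuelRank u := by
        rw [← one_add_samuelRank_sub_one h hu]
        exact (add_lt_add_iff_left 1).2 ha'
      have hγ0 : 0 < 1 + a' := lt_of_lt_of_le zero_lt_one le_self_add
      obtain ⟨z, w, hz0, hzγ, hw, hwo⟩ := key u v hu hv huv (1 + a') hγ0 hγ
      have hw0 : w ≠ 0 := by rw [hw]; exact mul_ne_zero hz0 hv
      have hza : a' ≤ samuelRank z - 1 := Ordinal.le_sub_of_add_le hzγ
      have hIH := IH z hz0 (by rw [← hw]; exact hwo)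
      have hwo' : samuelRank (z * v) - 1 < o - 1 := by
        rw [← hw, ← add_lt_add_iff_left 1, one_add_samuelRank_sub_one h hw0, ho1]
        exact hwo
      exact ((nadd_le_nadd_right hza _).trans hIH).trans_lt hwo'
    rw [nadd_le_iff]
    constructor
    · exact step x y hx hy rfl fun z hz0 hlt ↦ ih _ hlt z y hz0 hy rfl
    · intro b' hb'
      rw [nadd_comm]
      exact step y x hy hx (mul_comm y x) (fun z hz0 hlt ↦ ih _ hlt z x hz0 hx rfl) b' hb'

/-- The ordinal-sum form of the tree (`samuelRank_sub_one_add_le`) is recovered from the natural-sum form, as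
`α + β ≤ α ⊕ β` («≥ both ordinal sums»). [cite: ConidisNielsenTombs2019, Lemma 5 (§3)] -/
theorem samuelRank_sub_one_add_le_of_nadd (h : ∀ z : R, ∃ β : Ordinal.{u}, z ∈ samuelSet R β) {x y : R} (hx : x ≠ 0)
    (hy : y ≠ 0) :
    (samuelRank x - 1) + (samuelRank y - 1) ≤ samuelRank (x * y) - 1 ∧
      (samuelRank y - 1) + (samuelRank x - 1) ≤ samuelRank (x * y) - 1 :=
  ⟨(add_le_nadd _ _).trans (samuelRank_sub_one_nadd_le h hx hy),
    (add_le_nadd' _ _).trans (samuelRank_sub_one_nadd_le h hx hy)⟩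

/-- **«`τ(x^{n+1}) ≥ ⊕_{i=1}^{n+1} τ(x)`»**: the `n`-fold natural sum of `τ(x)` is at most `τ(xⁿ)` (the display in the
proof of Corollary 6). [cite: ConidisNielsenTombs2019, Cor. 6 (proof, §3)] -/
theorem samuelRank_sub_one_nadd_iterate_le (h : ∀ z : R, ∃ β : Ordinal.{u}, z ∈ samuelSet R β) {x : R} (hx : x ≠ 0)
    (n : ℕ) : (fun o : Ordinal.{u} ↦ nadd o (samuelRank x - 1))^[n] 0 ≤ samuelRank (x ^ n) - 1 := by
  induction n with
  | zero => exact bot_le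
  | succ n ih =>
    rw [Function.iterate_succ_apply', pow_succ]
    exact (nadd_le_nadd_right ih _).trans (samuelRank_sub_one_nadd_le h (pow_ne_zero n hx) hx)

/-- In terms of `θ = 1 + τ` itself: `1 + (τ(x) ⊕ τ(y)) ≤ θ(xy)` for `x, y ≠ 0`. [cite: ConidisNielsenTombs2019, Lemma 5 (§3)] -/
theorem nadd_samuelRank_sub_one_le (h : ∀ z : R, ∃ β : Ordinal.{u}, z ∈ samuelSet R β) {x y : R} (hx : x ≠ 0)
    (hy : y ≠ 0) : 1 + nadd (samuelRank x - 1) (samuelRank y - 1) ≤ samuelRank (x * y) := by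
  calc 1 + nadd (samuelRank x - 1) (samuelRank y - 1)
      ≤ 1 + (samuelRank (x * y) - 1) := add_le_add le_rfl (samuelRank_sub_one_nadd_le h hx hy)
    _ = samuelRank (x * y) := one_add_samuelRank_sub_one h (mul_ne_zero hx hy)

end Literature.Algebra.EuclideanDomain
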